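import Summits.AtomisticToContinuum.HydrodynamicLimit.Theses.OneSphereInfluence
import Literature.MathematicalPhysics.KineticTheory.HardSphereEulerProofs
import Literature.Probability.Moments.EfronStein
import Literature.MathematicalPhysics.StatisticalMechanics.CanonicalGasSpectralGap

/-!
# Birth skeleton (BC3) for crux `HardCorePoincare`
(stmt-AtomisticToContinuum-13619, route `OneSphereInfluence`, rank 4; file `Lines/birth.lean`)

Crux (FIXED, imported BY NAME):
`Summit.AtomisticToContinuum.HydrodynamicLimit.Theses.OneSphereInfluence.HardCorePoincare` — for continuous
`a₁, θ₁ > 0`, `u₁` there is `σ₀` such that for `0 < σ < σ₀` there is `C` with, for every `N`, flow `Φ` and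
`F ∈ L²(G)`, `G := localGibbsLaw σ a₁ u₁ θ₁ N Φ` (canonical local Gibbs law of `N+1` spheres of diameter
`σ(N+1)^{-1/3}` on `𝕋³`):  `Var_G(F) ≤ C · Σᵢ E_G[Var_G(F | z_{−i})]`  (heat-bath "resample one sphere"
Dirichlet form; `z_{−i}` = the σ-algebra `comap (z ↦ z ∘ i.succAbove) pi`).

## The line: BASE ⊕ FIBRE (positions ⊕ Maxwellian velocity marks), glued by the law of total variance

`G` disintegrates (in tree: `lintegral_localGibbsMeasure`, `localGibbsMeasure_preimage_pos`, `velMeasure`) as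
positions `x ~ π := posGibbsMeasure a₁ (hsDiameter σ N) (N+1)` (canonical INHOMOGENEOUS hard-core gas with
activity `a₁`) and, given `x`, independent velocities `vⱼ ~ N(u₁(xⱼ), θ₁(xⱼ)·id)`.  With `m_pos := σ(positions)`,
`Var F = E[Var(F | m_pos)] + Var(E[F | m_pos])` (Mathlib `integral_condVar_add_variance_condExp`) and:

* `stub_posGapMarginal` (L, HARDEST, the substance of the crux): N-uniform heat-bath Poincaré inequality for the
  configurational measure `π` itself — `Var_π(g) ≤ C Σᵢ E_π Var_π(g | x_{−i})` at small packing, `C = C(a₁, σ)`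
  uniform in `N`; no velocities, no `θ₁, u₁`.  Homogeneous core IN TREE and PROVED:
  `Literature.MathematicalPhysics.StatisticalMechanics.BCDP2006_canonicalGas_gap(_holds)` (Boudou–Caputo–Dai Pra–Posta,
  JFA 232 (2006) §5 Cor., arXiv:math/0505533 p. 13; uniform-proposal Dirichlet form ≤ heat-bath form); the
  inhomogeneous-activity version is NOT in print — refuter paper route (item evidence ATTACK.md / EVIDENCE.md):
  Dobrushin row sum `r = 16η(sup a₁/⨍a₁)/(1−8η sup a₁/⨍a₁)`, `8η = (4π/3)σ³` `N`-independent, then Wu 2006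
  (doi:10.1214/009117906000000368) Poincaré `C = (1−r)⁻¹` for exactly this Gibbs-sampler Dirichlet form; or
  Kannan–Mahoney–Montenegro 2003 path coupling (doi:10.1007/978-3-540-24587-2_68) at `ρ ≤ (1−δ)/2^{d+1}`.
* `stub_posMarginalTransfer` (M): `PosGapMarginal → PosGap` — the same inequality for POSITIONAL observables of the
  phase-space law (`F` measurable w.r.t. `m_pos`): Doob–Dynkin factorisation `F = g ∘ pos`, `map pos G = π`
  (`localGibbsMeasure_preimage_pos`), and the disintegration identity "resampling `zᵢ = (xᵢ,vᵢ)` given `z_{−i}`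
  resamples `xᵢ` from `π(· | x_{−i})`" so that `E_G Var_G(g∘pos | z_{−i}) = E_π Var_π(g | x_{−i})`.
* `stub_velFibre` (M): `E_G[Var_G(F | m_pos)] ≤ Σᵢ E_G[Var_G(F | z_{−i})]` — Efron–Stein with constant ONE in the
  Gaussian product fibre (IN TREE, PROVED: `Literature.Probability.Moments.EfronSteinInequality(_holds)`, resample
  form over `Measure.pi`), conditionally on the positions, plus monotonicity of expected conditional variance
  under refinement `σ(x, v_{−i}) ⊇ σ(z_{−i})`.
* `stub_jensenTransfer` (M): `E_G Var_G(E[F|m_pos] | z_{−i}) ≤ E_G Var_G(F | z_{−i})` for each `i` — convexity of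
  the variance (Jensen/Minkowski over `v_{−i}`, whose law given `x` does not involve `xᵢ`) and "variance of a
  conditional mean ≤ conditional variance" (integrating out `vᵢ`).

Composition `HardCorePoincare_of` (PROVED below, no `sorry`): `σ₀ := min σ₀(PosGap) (1/2)` so that `G` is a
probability measure (`isProbabilityMeasure_localGibbsLaw`, the refuters' read-back: take `σ₀ ≤ 1/2`), constant
`C + 1` (`N = 0` forces `≥ 1`: honoured), `m_pos ≤ ambient` (`Measurable.comap_le`), law of total variance,
`MemLp.condExp`, `stronglyMeasurable_condExp`, then linear arithmetic.  Sorries ONLY in the four `stub_*`.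

Disproof used: none filed for this crux (`ledger crux ls stmt-AtomisticToContinuum-13619`: no workfiles, no
`Disproof.lean`, no landed `Theorems/HardCorePoincare/Negative/*` at registration time).  Refuter constraints
honoured: `N = 0 ⇒ C ≥ 1` (constant `C+1`); `σ ≤ 1/2` normalisability; `MemLp` kept on every stub.
-/

noncomputable section

open MeasureTheory ProbabilityTheory Filter Topology
open scoped BigOperators ENNReal

namespace Summit.AtomisticToContinuum.HydrodynamicLimit.Cruxes.HardCorePoincare.Birth

open Literature.MathematicalPhysics.KineticTheory Literature.Analysis.FluidPDE
open Summit.AtomisticToContinuum.HydrodynamicLimit.Theses.OneSphereInfluence (HardCorePoincare)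

/-! ### The two σ-algebras of the line (abbreviations only; both are literal sub-terms of the crux / its fibre) -/

/-- `m_pos`: the σ-algebra generated by the POSITIONS `(z j).1`, `j : Fin (N+1)`, of a phase point. -/
abbrev mPos (N : ℕ) : MeasurableSpace (Config (N + 1) (Fin 3) T3) :=
  MeasurableSpace.comap (fun (z : Config (N + 1) (Fin 3) T3) (j : Fin (N + 1)) => (z j).1) MeasurableSpace.pi

/-- `σ(z_{−i})`: the σ-algebra generated by all spheres but `i` — VERBATIM the conditioning σ-algebra of the crux. -/
abbrev mDrop (N : ℕ) (i : Fin (N + 1)) : MeasurableSpace (Config (N + 1) (Fin 3) T3) :=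
  MeasurableSpace.comap (fun (z : Config (N + 1) (Fin 3) T3) (j : Fin N) => z (i.succAbove j)) MeasurableSpace.pi

/-- `σ(x_{−i})` on configurations of positions only (the base of the disintegration). -/
abbrev mDropPos (N : ℕ) (i : Fin (N + 1)) : MeasurableSpace (Fin (N + 1) → T3) :=
  MeasurableSpace.comap (fun (x : Fin (N + 1) → T3) (j : Fin N) => x (i.succAbove j)) MeasurableSpace.pi

/-! ### The four pieces -/

/-- PIECE 1 (L, hardest) — **canonical inhomogeneous hard-core heat-bath Poincaré inequality for the
configurational Gibbs measure** `π = posGibbsMeasure a₁ (hsDiameter σ N) (N+1)` (`N+1` sphere centres of diameter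
`σ(N+1)^{-1/3}` on `𝕋³`, one-body activity `a₁`, canonical ensemble): for continuous `a₁ > 0` there is `σ₀ > 0`
such that for `0 < σ < σ₀` some `C = C(a₁,σ) > 0` works for EVERY `N`:
`Var_π(g) ≤ C Σᵢ ∫ Var_π(g | x_{−i}) dπ` for all `g ∈ L²(π)`.  No velocity marks, no `θ₁, u₁`. -/
def PosGapMarginal : Prop :=
  ∀ (a₁ : T3 → ℝ), Continuous a₁ → (∀ x, 0 < a₁ x) →
    ∃ σ₀ : ℝ, 0 < σ₀ ∧ ∀ σ : ℝ, 0 < σ → σ < σ₀ → ∃ C : ℝ, 0 < C ∧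
      ∀ (N : ℕ) (g : (Fin (N + 1) → T3) → ℝ),
        MemLp g 2 (posGibbsMeasure a₁ (hsDiameter σ N) (N + 1)) →
        variance g (posGibbsMeasure a₁ (hsDiameter σ N) (N + 1)) ≤
          C * ∑ i : Fin (N + 1), ∫ x, condVar (mDropPos N i) g (posGibbsMeasure a₁ (hsDiameter σ N) (N + 1)) x
            ∂(posGibbsMeasure a₁ (hsDiameter σ N) (N + 1))

/-- Intermediate node — the crux restricted to POSITIONAL observables of the phase-space law: the same shape as
`HardCorePoincare` but only for `F` (strongly) measurable with respect to `m_pos`. -/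
def PosGap : Prop :=
  ∀ (a₁ θ₁ : T3 → ℝ) (u₁ : T3 → V3), Continuous a₁ → Continuous θ₁ → Continuous u₁ →
    (∀ x, 0 < a₁ x) → (∀ x, 0 < θ₁ x) →
    ∃ σ₀ : ℝ, 0 < σ₀ ∧ ∀ σ : ℝ, 0 < σ → σ < σ₀ → ∃ C : ℝ, 0 < C ∧
      ∀ (N : ℕ) (Φ : HardSphereFlow (Torus.geometry (Fin 3)) (hsDiameter σ N) (N + 1))
        (F : Config (N + 1) (Fin 3) T3 → ℝ),
        MemLp F 2 (localGibbsLaw σ a₁ u₁ θ₁ N Φ) →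
        StronglyMeasurable[mPos N] F →
        variance F (localGibbsLaw σ a₁ u₁ θ₁ N Φ) ≤
          C * ∑ i : Fin (N + 1), ∫ z, condVar (mDrop N i) F (localGibbsLaw σ a₁ u₁ θ₁ N Φ) z
            ∂(localGibbsLaw σ a₁ u₁ θ₁ N Φ)

/-- PIECE 3 (M) — **Efron–Stein in the Gaussian velocity fibre**: conditionally on the positions the velocities
are independent `N(u₁(xⱼ), θ₁(xⱼ) id)`, so the expected conditional variance given the positions is bounded by the
heat-bath Dirichlet form with constant ONE (tensorisation in the fibre + monotonicity of expected conditional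
variance under the refinement `σ(x, v_{−i}) ⊇ σ(z_{−i})`).  Stated for `0 < σ ≤ 1/2` (normalisable regime). -/
def VelFibre : Prop :=
  ∀ (a₁ θ₁ : T3 → ℝ) (u₁ : T3 → V3), Continuous a₁ → Continuous θ₁ → Continuous u₁ →
    (∀ x, 0 < a₁ x) → (∀ x, 0 < θ₁ x) →
    ∀ σ : ℝ, 0 < σ → σ ≤ 1 / 2 →
      ∀ (N : ℕ) (Φ : HardSphereFlow (Torus.geometry (Fin 3)) (hsDiameter σ N) (N + 1))
        (F : Config (N + 1) (Fin 3) T3 → ℝ),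
        MemLp F 2 (localGibbsLaw σ a₁ u₁ θ₁ N Φ) →
        ∫ z, condVar (mPos N) F (localGibbsLaw σ a₁ u₁ θ₁ N Φ) z ∂(localGibbsLaw σ a₁ u₁ θ₁ N Φ) ≤
          ∑ i : Fin (N + 1), ∫ z, condVar (mDrop N i) F (localGibbsLaw σ a₁ u₁ θ₁ N Φ) z
            ∂(localGibbsLaw σ a₁ u₁ θ₁ N Φ)

/-- PIECE 4 (M) — **Jensen transfer**: averaging out the velocities can only decrease each heat-bath term,
`∫ Var(E[F | m_pos] | z_{−i}) ≤ ∫ Var(F | z_{−i})` for every `i` (the law of `v_{−i}` given the positions does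
not involve `xᵢ`; convexity of the variance + "variance of a conditional mean ≤ conditional variance"). -/
def JensenTransfer : Prop :=
  ∀ (a₁ θ₁ : T3 → ℝ) (u₁ : T3 → V3), Continuous a₁ → Continuous θ₁ → Continuous u₁ →
    (∀ x, 0 < a₁ x) → (∀ x, 0 < θ₁ x) →
    ∀ σ : ℝ, 0 < σ → σ ≤ 1 / 2 →
      ∀ (N : ℕ) (Φ : HardSphereFlow (Torus.geometry (Fin 3)) (hsDiameter σ N) (N + 1))
        (F : Config (N + 1) (Fin 3) T3 → ℝ),
        MemLp F 2 (localGibbsLaw σ a₁ u₁ θ₁ N Φ) →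
        ∀ i : Fin (N + 1),
          ∫ z, condVar (mDrop N i) (condExp (mPos N) (localGibbsLaw σ a₁ u₁ θ₁ N Φ) F)
              (localGibbsLaw σ a₁ u₁ θ₁ N Φ) z ∂(localGibbsLaw σ a₁ u₁ θ₁ N Φ) ≤
            ∫ z, condVar (mDrop N i) F (localGibbsLaw σ a₁ u₁ θ₁ N Φ) z ∂(localGibbsLaw σ a₁ u₁ θ₁ N Φ)

/-! ### Registered stubs (the open obligations of the line; `sorry` only here) -/

/-- STUB 1 (L, HARDEST): the configurational canonical hard-core heat-bath Poincaré inequality. -/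
theorem stub_posGapMarginal : PosGapMarginal := by
  sorry

/-- STUB 2 (M): marginal transfer — positional observables of the phase-space law reduce to `π`. -/
theorem stub_posMarginalTransfer : PosGapMarginal → PosGap := by
  sorry

/-- STUB 3 (M): Efron–Stein (constant one) in the Gaussian velocity fibre. -/
theorem stub_velFibre : VelFibre := by
  sorry

/-- STUB 4 (M): Jensen transfer of the heat-bath Dirichlet form under velocity averaging. -/
theorem stub_jensenTransfer : JensenTransfer := by
  sorry

/-! ### Name-keyed aliases of the stub statements (the hypotheses of the composition; the skeleton audit admits a
hypothesis only if its head constant is a registered obligation or is named like a declared stub) -/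
namespace Registered

/-- Alias of `PosGapMarginal` keyed by the registered stub name. -/
abbrev stub_posGapMarginal : Prop := PosGapMarginal
/-- Alias of `PosGapMarginal → PosGap` keyed by the registered stub name. -/
abbrev stub_posMarginalTransfer : Prop := PosGapMarginal → PosGap
/-- Alias of `VelFibre` keyed by the registered stub name. -/
abbrev stub_velFibre : Prop := VelFibre
/-- Alias of `JensenTransfer` keyed by the registered stub name. -/
abbrev stub_jensenTransfer : Prop := JensenTransfer

end Registered

/-! ### The composition (PROVED): base ⊕ fibre via the law of total variance -/

/-- **The line concludes the crux BY NAME**: the four registered stubs imply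
`Summit.AtomisticToContinuum.HydrodynamicLimit.Theses.OneSphereInfluence.HardCorePoincare` (no `sorry`):
`Var F = E Var(F|m_pos) + Var E[F|m_pos] ≤ Σᵢ E Var(F|z_{−i}) + C Σᵢ E Var(E[F|m_pos] | z_{−i}) ≤ (C+1) Σᵢ E Var(F|z_{−i})`. -/
theorem HardCorePoincare_of (hP : Registered.stub_posGapMarginal) (hT : Registered.stub_posMarginalTransfer)
    (hV : Registered.stub_velFibre) (hJ : Registered.stub_jensenTransfer) : HardCorePoincare := by
  have hGap : PosGap := hT hP
  intro a₁ θ₁ u₁ ha hθ hu ha0 hθ0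
  obtain ⟨σ₀, hσ₀, hgap⟩ := hGap a₁ θ₁ u₁ ha hθ hu ha0 hθ0
  refine ⟨min σ₀ (1 / 2), lt_min hσ₀ (by norm_num), fun σ hσ hσlt => ?_⟩
  have hσ₁ : σ < σ₀ := hσlt.trans_le (min_le_left _ _)
  have hσ2 : σ ≤ 1 / 2 := (hσlt.trans_le (min_le_right _ _)).le
  obtain ⟨C, hC, hgapσ⟩ := hgap σ hσ hσ₁
  refine ⟨C + 1, by positivity, fun N Φ F hF => ?_⟩
  haveI : IsProbabilityMeasure (localGibbsLaw σ a₁ u₁ θ₁ N Φ) :=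
    isProbabilityMeasure_localGibbsLaw ha hθ hu ha0 hθ0 hσ2 N Φ
  -- the positional σ-algebra is a sub-σ-algebra of the phase-space σ-algebra
  have hm : mPos N ≤ (inferInstance : MeasurableSpace (Config (N + 1) (Fin 3) T3)) :=
    Measurable.comap_le (measurable_pi_lambda _ fun j => (measurable_pi_apply j).fst)
  -- law of total variance: E Var(F | m_pos) + Var(E[F | m_pos]) = Var F
  have htot := integral_condVar_add_variance_condExp hm hF
  -- fibre: E Var(F | m_pos) ≤ Σᵢ E Var(F | z_{−i})
  have h1 := hV a₁ θ₁ u₁ ha hθ hu ha0 hθ0 σ hσ hσ2 N Φ F hF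
  -- base: Var(E[F | m_pos]) ≤ C Σᵢ E Var(E[F | m_pos] | z_{−i})  (E[F | m_pos] is m_pos-measurable, in L²)
  have h2 := hgapσ N Φ (condExp (mPos N) (localGibbsLaw σ a₁ u₁ θ₁ N Φ) F) (hF.condExp one_le_two)
    stronglyMeasurable_condExp
  -- Jensen: Σᵢ E Var(E[F | m_pos] | z_{−i}) ≤ Σᵢ E Var(F | z_{−i})
  have h3 := Finset.sum_le_sum fun i (_ : i ∈ (Finset.univ : Finset (Fin (N + 1)))) =>
    hJ a₁ θ₁ u₁ ha hθ hu ha0 hθ0 σ hσ hσ2 N Φ F hF i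
  have h4 := mul_le_mul_of_nonneg_left h3 hC.le
  show variance F (localGibbsLaw σ a₁ u₁ θ₁ N Φ) ≤
    (C + 1) * ∑ i : Fin (N + 1), ∫ z, condVar (mDrop N i) F (localGibbsLaw σ a₁ u₁ θ₁ N Φ) z
      ∂(localGibbsLaw σ a₁ u₁ θ₁ N Φ)
  linarith [htot, h1, h2, h4]

/-- Wiring check: the registered stubs feed `HardCorePoincare_of` as stated. -/
example : HardCorePoincare :=
  HardCorePoincare_of stub_posGapMarginal stub_posMarginalTransfer stub_velFibre stub_jensenTransfer

end Summit.AtomisticToContinuum.HydrodynamicLimit.Cruxes.HardCorePoincare.Birth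

end
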